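import Summits.KontsevichZagierPeriods.Zeta5Search.TwoTaleOmega.OmegaRegion
import Summits.KontsevichZagierPeriods.Zeta5Search.TwoTaleOmega.OmegaKitT

/-!
# (bmiss)@Ω — instance kit C: the second-tale hinge data on the even lattice, removable points, second-tale nodes
(cell `pub-zeta5`, cert-1 gen 4)

HONEST FRAMING: systematic search; recurrence certificates; no irrationality claim unless certified. Pure finite algebra
over `ℚ`/`ℤ`; no named fact.

OUR infrastructure for the SECOND-TALE sides of the per-direction instances (blueprint `families/tele/RECURRENCE.md`
§13.10–13.12; fam-tele's `OmegaKitT`). In the lattice variable `u = 2t` the second-tale integrand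
`F_R(p;u) = κ(p)·block(a+1,g−b+a)(u)·block(a−b+1,f)(u/2)/(block(e,e+f)(u/2)·block(a,g)(u/2))` (`Pt.vR_eval_blocks`) has its
poles on the EVEN lattice `u = −2i`; this file provides
* even blocks `eblock lo hi = ∏ (X + 2i)` with `eval_block_half : block(u/2) = (1/2)^n · eblock(u)`;
* two-range denominators `denom (A ∪ B) (twoRange A B) = ∏_A (X+K) · ∏_B (X+K)` (multiplicity `2` on `A ∩ B`);
* the CLOSED FORM `Pt.vR_eq_ofFrac : vR p = ofFrac (A ∪ B) (twoRange A B) (C(κ·2^{g−b+1})·block(a+1,g−b+a)·eblock(a−b+1,f))`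
  with `A = 2·[e,e+f)`, `B = 2·[a,g)` (Lemma U);
* REMOVABLE points: `PF.ofFrac_erase` (a simple point of `S` whose factor divides `N` may be erased) and
  `PF.eval_ofFrac_removable_zero` (double zero of `N` at a simple point of `S` ⇒ value `0`) — needed because the
  second-tale node moves cross lattice points `u = −2i`, `e ≤ i < f`, which are formal poles cancelled by double zeros;
* the second-tale WINDOW: `Pt.altRes_vR_zero` — for `1 − â₀* ≤ σ ≤ −a−1` both formal residues of `vR p` at `u = σ` vanish
  (simple zero of `block(a+1,g−b+a)`, doubled by `eblock(a−b+1,f)` exactly at the formal poles), hence `Pt.altE_vR_move`.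
-/

noncomputable section

open Finset Polynomial
open Literature.NumberTheory.Irrationality.Zudilin2014
open Summit.KontsevichZagierPeriods.Zeta5Search.FormalBarnes

namespace Summit.KontsevichZagierPeriods.Zeta5Search.FormalBarnes

/-! ### Even blocks -/

/-- The even-lattice block `∏_{lo ≤ i < hi} (X + 2i)`. -/
def eblock (lo hi : ℤ) : ℚ[X] := ∏ i ∈ Ico lo hi, lin (2 * i)

/-- Value of an even block. -/
theorem eval_eblock (lo hi : ℤ) (u : ℚ) : (eblock lo hi).eval u = ∏ i ∈ Ico lo hi, (u + 2 * i) := by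
  unfold eblock; rw [eval_prod]
  exact prod_congr rfl fun i _ => by rw [eval_lin]; push_cast; ring

/-- `eblock ≠ 0`. -/
theorem eblock_ne_zero (lo hi : ℤ) : eblock lo hi ≠ 0 :=
  prod_ne_zero_iff.2 fun _ _ => (monic_lin _).ne_zero

/-- Degree of an even block. -/
theorem natDegree_eblock (lo hi : ℤ) : (eblock lo hi).natDegree = (hi - lo).toNat := by
  unfold eblock
  rw [natDegree_prod_of_monic _ _ fun _ _ => monic_lin _]
  unfold lin; simp_rw [natDegree_X_add_C]
  rw [sum_const, Int.card_Ico, smul_eq_mul, mul_one]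

/-- `(X + 2i) ∣ eblock lo hi` for `lo ≤ i < hi`. -/
theorem lin_dvd_eblock {lo hi i : ℤ} (h1 : lo ≤ i) (h2 : i < hi) : lin (2 * i) ∣ eblock lo hi :=
  dvd_prod_of_mem _ (mem_Ico.2 ⟨h1, h2⟩)

/-- An even block as a product over its (even) root set. -/
theorem eblock_eq_prod_image (lo hi : ℤ) : eblock lo hi = ∏ K ∈ (Ico lo hi).image (fun i => 2 * i), lin K := by
  unfold eblock
  rw [prod_image fun x _ y _ h => mul_left_cancel₀ two_ne_zero h]

/-- **Half-argument evaluation**: `block lo hi (u/2) = (1/2)^{hi−lo} · eblock lo hi (u)`. -/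
theorem eval_block_half (lo hi : ℤ) (u : ℚ) :
    (block lo hi).eval (u / 2) = (1 / 2) ^ (hi - lo).toNat * (eblock lo hi).eval u := by
  rw [eval_block, eval_eblock, ← Int.card_Ico, ← prod_const, ← prod_mul_distrib]
  exact prod_congr rfl fun i _ => by ring

/-- Peeling the lowest factor off an even block. -/
theorem eblock_succ_left {lo hi : ℤ} (h : lo < hi) : eblock lo hi = lin (2 * lo) * eblock (lo + 1) hi := by
  unfold eblock
  have : Ico lo hi = insert lo (Ico (lo + 1) hi) := by
    ext i; simp only [mem_Ico, mem_insert]; omega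
  rw [this, prod_insert (by simp)]

/-- Peeling the top factor off an even block. -/
theorem eblock_succ_right {lo hi : ℤ} (h : lo ≤ hi) : eblock lo (hi + 1) = eblock lo hi * lin (2 * hi) := by
  unfold eblock
  have : Ico lo (hi + 1) = insert hi (Ico lo hi) := by
    ext i; simp only [mem_Ico, mem_insert]; omega
  rw [this, prod_insert (by simp), mul_comm]

/-- Peeling the top factor off an ordinary block. -/
theorem block_succ_right {lo hi : ℤ} (h : lo ≤ hi) : block lo (hi + 1) = block lo hi * lin hi := by
  rw [← block_single, block_mul_block h (by omega)]

/-! ### Two-range denominators (multiplicity `2` on the overlap) -/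

/-- Multiplicity function of the union of two simple-pole ranges. -/
def twoRange (A B : Finset ℤ) (K : ℤ) : ℕ := (if K ∈ A then 1 else 0) + (if K ∈ B then 1 else 0)

/-- On `A ∪ B` the multiplicities are `1` or `2`. -/
theorem twoRange_mem {A B : Finset ℤ} {K : ℤ} (hK : K ∈ A ∪ B) : twoRange A B K = 1 ∨ twoRange A B K = 2 := by
  unfold twoRange
  rcases mem_union.1 hK with h | h <;> by_cases h' : K ∈ B <;> by_cases h'' : K ∈ A <;> simp_all

/-- The two-range denominator is the product of the two simple products. -/
theorem denom_twoRange (A B : Finset ℤ) :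
    denom (A ∪ B) (twoRange A B) = (∏ K ∈ A, lin K) * ∏ K ∈ B, lin K := by
  rw [denom_eq]
  unfold twoRange
  simp_rw [pow_add, prod_mul_distrib, pow_ite, pow_one, pow_zero]
  rw [prod_ite_mem, prod_ite_mem, union_inter_cancel_left, union_inter_cancel_right]
  rfl

/-- Total multiplicity of a two-range denominator. -/
theorem sum_twoRange (A B : Finset ℤ) : ∑ K ∈ A ∪ B, twoRange A B K = A.card + B.card := by
  unfold twoRange
  rw [sum_add_distrib, sum_boole, sum_boole, filter_mem_eq_inter, filter_mem_eq_inter, union_inter_cancel_left,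
    union_inter_cancel_right]
  simp

/-! ### Removable points of closed-form data -/

/-- **Erasing a removable simple point**: if `K ∈ S` has multiplicity `1` and `(X+K) ∣ N`, the closed-form data of
`N/D_{S,m}` coincide with those of `(N/(X+K))/D_{S∖K,m}`. -/
theorem PF.ofFrac_erase (S : Finset ℤ) (m : ℤ → ℕ) (N N₁ : ℚ[X]) (hm : ∀ k ∈ S, m k = 1 ∨ m k = 2) {K : ℤ}
    (hK : K ∈ S) (hmK : m K = 1) (hN : N = lin K * N₁) : PF.ofFrac S m N = PF.ofFrac (S.erase K) m N₁ := by
  refine PF.eq_of_eval_eq_on _ _ S (PF.poles_ofFrac _ _ _) ((PF.poles_ofFrac _ _ _).trans (erase_subset _ _))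
    fun u hu => ?_
  have hu' : ∀ k ∈ S.erase K, u + k ≠ 0 := fun k hk => hu k (mem_of_mem_erase hk)
  rw [PF.eval_ofFrac S m N hm hu, PF.eval_ofFrac (S.erase K) m N₁ (fun k hk => hm k (mem_of_mem_erase hk)) hu']
  have hD : denom S m = lin K * denom (S.erase K) m := by
    rw [denom_eq, denom_eq, ← mul_prod_erase _ _ hK, hmK, pow_one]; rfl
  rw [hD, hN, Polynomial.eval_mul, Polynomial.eval_mul, eval_lin]
  have hK0 : u + K ≠ 0 := hu K hK
  field_simp

/-- **Value at a removable point**: a double zero of `N` at a simple point `K ∈ S` gives the value `0` at `u = −K`. -/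
theorem PF.eval_ofFrac_removable_zero (S : Finset ℤ) (m : ℤ → ℕ) (N : ℚ[X]) (hm : ∀ k ∈ S, m k = 1 ∨ m k = 2)
    {K : ℤ} (hK : K ∈ S) (hmK : m K = 1) (hdvd : lin K ^ 2 ∣ N) : (PF.ofFrac S m N).eval (-(K : ℚ)) = 0 := by
  obtain ⟨Q, hQ⟩ := hdvd
  rw [PF.ofFrac_erase S m N (lin K * Q) hm hK hmK (by rw [hQ]; ring)]
  have h := PF.eval_ofFrac_eq_zero_of_dvd (S.erase K) m (lin K * Q) (fun k hk => hm k (mem_of_mem_erase hk))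
    (M := -K) (by rw [neg_neg]; exact notMem_erase K S) (by rw [neg_neg]; exact dvd_mul_right _ _)
  push_cast at h
  exact h

end Summit.KontsevichZagierPeriods.Zeta5Search.FormalBarnes

namespace Summit.KontsevichZagierPeriods.Zeta5Search.TwoTaleOmega

namespace Pt

variable (p : Pt)

/-! ### The second-tale hinge data in closed form -/

/-- The simple-pole range `2·[e, e+f)` of the second-tale integrand (in `u`). -/
def AR : Finset ℤ := (Ico p.e (p.e + p.f)).image (fun i => 2 * i)

/-- The pole range `2·[a, g)` of the second-tale integrand (in `u`). -/
def BR : Finset ℤ := (Ico p.a p.g).image (fun i => 2 * i)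

/-- The numerator of the second-tale integrand on the even lattice: `κ·2^{g−b+1}·block(a+1,g−b+a)·eblock(a−b+1,f)`. -/
def NR : ℚ[X] := C (p.kap * 2 ^ (p.g - p.b + 1).toNat) * (block (p.a + 1) (p.g - p.b + p.a) * eblock (p.a - p.b + 1) p.f)

variable {p}

/-- Membership in `AR`. -/
theorem mem_AR {K : ℤ} : K ∈ p.AR ↔ ∃ i, p.e ≤ i ∧ i < p.e + p.f ∧ K = 2 * i := by
  unfold AR; simp only [mem_image, mem_Ico]; constructor
  · rintro ⟨i, ⟨h1, h2⟩, rfl⟩; exact ⟨i, h1, h2, rfl⟩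
  · rintro ⟨i, h1, h2, rfl⟩; exact ⟨i, ⟨h1, h2⟩, rfl⟩

/-- Membership in `BR`. -/
theorem mem_BR {K : ℤ} : K ∈ p.BR ↔ ∃ i, p.a ≤ i ∧ i < p.g ∧ K = 2 * i := by
  unfold BR; simp only [mem_image, mem_Ico]; constructor
  · rintro ⟨i, ⟨h1, h2⟩, rfl⟩; exact ⟨i, h1, h2, rfl⟩
  · rintro ⟨i, h1, h2, rfl⟩; exact ⟨i, ⟨h1, h2⟩, rfl⟩

/-- Off `−(AR ∪ BR)` the second-tale denominator does not vanish at `u/2`. -/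
theorem denT_ne_zero_of_avoid {u : ℚ} (hu : ∀ K ∈ p.AR ∪ p.BR, u + K ≠ 0) : (denT p.t2a p.t2b).eval (u / 2) ≠ 0 := by
  refine p.denT_eval_ne_zero (fun j hj => ?_) (fun j hj => ?_)
  · have := hu (2 * j) (mem_union.2 (Or.inl (mem_image.2 ⟨j, hj, rfl⟩))); push_cast at this; exact this
  · have := hu (2 * j) (mem_union.2 (Or.inr (mem_image.2 ⟨j, hj, rfl⟩))); push_cast at this; exact this

/-- `κ(p) ≠ 0`. -/
theorem kap_ne_zero : p.kap ≠ 0 := by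
  unfold kap eps
  refine div_ne_zero (mul_ne_zero (pow_ne_zero _ (by norm_num)) ?_) (facZ_ne_zero _)
  exact mul_ne_zero (mul_ne_zero (facZ_ne_zero _) (facZ_ne_zero _)) (facZ_ne_zero _)

/-- **`vR p` in closed form** (Lemma U): on Ω, `vR p = ofFrac (AR ∪ BR) (twoRange AR BR) NR`. -/
theorem vR_eq_ofFrac (h : p.Omega) : p.vR = PF.ofFrac (p.AR ∪ p.BR) (twoRange p.AR p.BR) p.NR := by
  have hr := t2_ranges h
  obtain ⟨o1, o2, o3, o4, o5, o6, o7, o8, o9⟩ := h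
  refine PF.eq_of_eval_eq_on _ _ (p.AR ∪ p.BR) ?_ (PF.poles_ofFrac _ _ _) fun u hu => ?_
  · refine (poles_vR p).trans (union_subset ?_ ?_) <;> intro K hK <;> obtain ⟨i, hi, rfl⟩ := mem_image.1 hK <;>
      rw [mem_Ico] at hi <;> rw [mem_union, mem_AR, mem_BR]
    · rw [hr.1, hr.2.2.2] at hi
      by_cases hie : i < p.e + p.f
      · exact Or.inl ⟨i, by omega, hie, rfl⟩
      · exact Or.inr ⟨i, by omega, by omega, rfl⟩
    · rw [hr.2.1, hr.2.2.1] at hi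
      exact Or.inr ⟨i, by omega, by omega, rfl⟩
  · rw [vR_eval_blocks p (Omega.admissibleT ⟨o1, o2, o3, o4, o5, o6, o7, o8, o9⟩) (denT_ne_zero_of_avoid hu),
      PF.eval_ofFrac _ _ _ (fun _ hk => twoRange_mem hk) hu, denom_twoRange, NR]
    unfold AR BR
    rw [← eblock_eq_prod_image, ← eblock_eq_prod_image, eval_block_half, eval_block_half, eval_block_half]
    simp only [Polynomial.eval_mul, Polynomial.eval_C]
    have hE1 : (eblock p.e (p.e + p.f)).eval u ≠ 0 := by
      rw [eval_eblock]; refine prod_ne_zero_iff.2 fun i hi h0 => hu (2 * i) (mem_union.2 (Or.inl (mem_image.2 ⟨i, hi, rfl⟩))) ?_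
      push_cast; exact h0
    have hE2 : (eblock p.a p.g).eval u ≠ 0 := by
      rw [eval_eblock]; refine prod_ne_zero_iff.2 fun i hi h0 => hu (2 * i) (mem_union.2 (Or.inr (mem_image.2 ⟨i, hi, rfl⟩))) ?_
      push_cast; exact h0
    have hpow : p.f.toNat + (p.g - p.a).toNat = (p.g - p.b + 1).toNat + (p.f - (p.a - p.b + 1)).toNat := by omega
    rw [show p.e + p.f - p.e = p.f by ring]
    have h2 : ((1:ℚ) / 2) ^ p.f.toNat * ((1:ℚ) / 2) ^ (p.g - p.a).toNat
        = ((1:ℚ) / 2) ^ (p.g - p.b + 1).toNat * ((1:ℚ) / 2) ^ (p.f - (p.a - p.b + 1)).toNat := by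
      rw [← pow_add, ← pow_add, hpow]
    have hq : ((1:ℚ) / 2) ^ (p.g - p.b + 1).toNat * (2:ℚ) ^ (p.g - p.b + 1).toNat = 1 := by
      rw [← mul_pow]; norm_num
    field_simp
    linear_combination (-(p.kap * (block (p.a + 1) (p.g - p.b + p.a)).eval u * (eblock (p.a - p.b + 1) p.f).eval u
        * (2:ℚ) ^ (p.g - p.b + 1).toNat)) * h2
      - (p.kap * (block (p.a + 1) (p.g - p.b + p.a)).eval u * (eblock (p.a - p.b + 1) p.f).eval u
        * ((1:ℚ) / 2) ^ (p.f - (p.a - p.b + 1)).toNat) * hq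

/-! ### The second-tale window: residues of `vR p` between its node and `u = −a−1` -/

/-- **Second-tale window.** For `1 − â₀* ≤ σ ≤ −a−1` both formal residues of `vR p` at `u = σ` vanish: `−σ` is a zero
of `block(a+1, g−b+a)`, and at the formal poles `−σ = 2i` (`e ≤ i < f`, multiplicity one) also of `eblock(a−b+1,f)`. -/
theorem altRes_vR_zero (h : p.Omega) {σ : ℤ} (hlo : 1 - a0star p.t2a ≤ σ) (hhi : σ + p.a + 1 ≤ 0) :
    altRes0 σ p.vR = 0 ∧ altRes1 σ p.vR = 0 := by
  have h0 := a0star_t2a_eq h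
  have hv := vR_eq_ofFrac h
  obtain ⟨o1, o2, o3, o4, o5, o6, o7, o8, o9⟩ := h
  have hm : ∀ k ∈ p.AR ∪ p.BR, twoRange p.AR p.BR k = 1 ∨ twoRange p.AR p.BR k = 2 := fun _ hk => twoRange_mem hk
  have hnotB : -σ ∉ p.BR := fun hB => by
    obtain ⟨i, hi1, hi2, hi3⟩ := mem_BR.1 hB; omega
  have hdvd1 : lin (-σ) ∣ block (p.a + 1) (p.g - p.b + p.a) := lin_dvd_block (by omega) (by omega)
  have hdvdN : lin (-σ) ∣ p.NR := by
    unfold NR; exact (hdvd1.mul_right _).mul_left _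
  have hdouble : (PF.ofFrac (p.AR ∪ p.BR) (twoRange p.AR p.BR) p.NR).double (-σ) = 0 :=
    PF.ofFrac_double_eq_zero _ _ _ fun ⟨_, h2⟩ => hnotB (by
      unfold twoRange at h2; by_cases hA : -σ ∈ p.AR <;> by_cases hB : -σ ∈ p.BR <;> simp [hA, hB] at h2 ⊢)
  rw [hv]
  refine ⟨?_, by unfold altRes1; rw [hdouble, mul_zero]⟩
  rw [altRes0_eq_eval]
  refine mul_eq_zero_of_right _ ?_
  by_cases hS : -σ ∈ p.AR ∪ p.BR
  · -- a formal pole of multiplicity one, cancelled by a double zero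
    have hA : -σ ∈ p.AR := (mem_union.1 hS).resolve_right hnotB
    obtain ⟨i, hi1, hi2, hi3⟩ := mem_AR.1 hA
    have hm1 : twoRange p.AR p.BR (-σ) = 1 := by unfold twoRange; rw [if_pos hA, if_neg hnotB]
    have hdvd2 : lin (-σ) ∣ eblock (p.a - p.b + 1) p.f := by
      rw [hi3]; exact lin_dvd_eblock (by omega) (by omega)
    have hsq : lin (-σ) ^ 2 ∣ p.NR := by
      unfold NR; rw [pow_two]; exact ((mul_dvd_mul hdvd1 hdvd2)).mul_left _
    have := PF.eval_ofFrac_removable_zero _ _ _ hm hS hm1 hsq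
    simpa using this
  · have := PF.eval_ofFrac_eq_zero_of_dvd _ _ _ hm (M := σ) hS hdvdN
    simpa using this

/-- **Second-tale node move**: `E_M[vR p] = E_{M+n}[vR p]` whenever the crossed points lie in the window. -/
theorem altE_vR_move (h : p.Omega) (M : ℤ) (n : ℕ) (d : ℕ) (hlo : 1 - a0star p.t2a ≤ M) (hhi : M + n + p.a ≤ 0) :
    altE0 d M p.vR = altE0 d (M + n) p.vR ∧ altE1 M p.vR = altE1 (M + n) p.vR := by
  have h0 := altE0_move d M p.vR (by rw [vR_poly]; simp) n
  have h1 := altE1_move M p.vR n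
  have hz : ∀ i ∈ range n, altRes0 (M + (i : ℕ)) p.vR = 0 ∧ altRes1 (M + (i : ℕ)) p.vR = 0 := fun i hi =>
    altRes_vR_zero h (σ := M + (i : ℕ)) (by omega) (by have := mem_range.1 hi; omega)
  rw [sum_eq_zero fun i hi => (hz i hi).1] at h0
  rw [sum_eq_zero fun i hi => (hz i hi).2] at h1
  constructor <;> linarith

/-! ### Γ-ratios of the second tale along `δ_b` and its `t`-shift -/

/-- Along `δ_b`: `F_R(p+kδ;u)·block(g−b−k+a, g−b+a)(u) = (−1)^k·∏_{j<k}(g−b−k+j)·block(a−b−k+1, a−b+1)(u/2)·F_R(p;u)`. -/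
theorem vR_ratio_addB (h : p.Omega) (k : ℕ) (hk : (p.addB k).Omega) {u : ℚ} (hu : ∀ K ∈ p.AR ∪ p.BR, u + K ≠ 0) :
    (p.addB k).vR.eval u * (block (p.g - p.b - k + p.a) (p.g - p.b + p.a)).eval u
      = (-1) ^ k * (∏ j ∈ range k, ((p.g : ℚ) - p.b - 1 - k + j + 1))
        * (block (p.a - p.b - k + 1) (p.a - p.b + 1)).eval (u / 2) * p.vR.eval u := by
  obtain ⟨o1, o2, o3, o4, o5, o6, o7, o8, o9⟩ := id h
  have q8 := hk.b3_le_g; simp only [addB_b, addB_g] at q8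
  have hden : (denT p.t2a p.t2b).eval (u / 2) ≠ 0 := denT_ne_zero_of_avoid hu
  have hdenk : (denT (p.addB k).t2a (p.addB k).t2b).eval (u / 2) ≠ 0 := by
    rw [denT_eq] at hden ⊢; simpa only [addB_a, addB_e, addB_f, addB_g] using hden
  rw [vR_eval_blocks _ hk.admissibleT hdenk, vR_eval_blocks _ h.admissibleT hden, kap_addB p k (by omega)]
  simp only [addB_a, addB_b, addB_e, addB_f, addB_g]
  rw [show p.g - (p.b + (k : ℤ)) + p.a = p.g - p.b - k + p.a by ring, show p.a - (p.b + (k : ℤ)) + 1 = p.a - p.b - k + 1 by ring,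
    ← block_mul_block (lo := p.a + 1) (mi := p.g - p.b - k + p.a) (hi := p.g - p.b + p.a) (by omega) (by omega),
    ← block_mul_block (lo := p.a - p.b - k + 1) (mi := p.a - p.b + 1) (hi := p.f) (by omega) (by omega)]
  simp only [Polynomial.eval_mul]
  have hE : (block p.e (p.e + p.f)).eval (u / 2) * (block p.a p.g).eval (u / 2) ≠ 0 := by
    rw [denT_eq, Polynomial.eval_mul] at hden; exact hden
  rw [div_mul_eq_mul_div, mul_div_assoc', div_left_inj' hE]
  ring

/-- **The `t`-shift of the second-tale integrand** (`t ↦ t+1` is `u ↦ u+2`):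
`F_R(p;u+2)·(u+a+1)(u+a+2)(t+a−b+1)(t+e+f)(t+g) = F_R(p;u)·(u+a−b+g)(u+a−b+g+1)(t+a)(t+e)(t+f)`, `t = u/2`. -/
theorem vR_shift (h : p.Omega) {u : ℚ} (hu : ∀ K ∈ p.AR ∪ p.BR, u + K ≠ 0) (hu2 : ∀ K ∈ p.AR ∪ p.BR, u + 2 + K ≠ 0) :
    p.vR.eval (u + 2) * ((u + p.a + 1) * (u + p.a + 2) * (u / 2 + (p.a - p.b + 1 : ℤ)) * (u / 2 + (p.e + p.f : ℤ))
        * (u / 2 + p.g))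
      = p.vR.eval u * ((u + (p.a - p.b + p.g : ℤ)) * (u + (p.a - p.b + p.g : ℤ) + 1) * (u / 2 + p.a) * (u / 2 + p.e)
        * (u / 2 + p.f)) := by
  obtain ⟨o1, o2, o3, o4, o5, o6, o7, o8, o9⟩ := id h
  have hden : (denT p.t2a p.t2b).eval (u / 2) ≠ 0 := denT_ne_zero_of_avoid hu
  have hden2 : (denT p.t2a p.t2b).eval ((u + 2) / 2) ≠ 0 := denT_ne_zero_of_avoid hu2
  rw [vR_eval_blocks _ h.admissibleT hden2, vR_eval_blocks _ h.admissibleT hden, show (u + 2) / 2 = u / 2 + 1 by ring]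
  rw [denT_eq, Polynomial.eval_mul] at hden hden2
  rw [show (u + 2) / 2 = u / 2 + 1 by ring] at hden2
  rw [div_mul_eq_mul_div, div_mul_eq_mul_div, div_eq_div_iff hden2 hden]
  have f1 := eval_block_succ_mul (lo := p.a + 1) (hi := p.g - p.b + p.a) (by omega) (u + 1)
  have f2 := eval_block_succ_mul (lo := p.a + 1) (hi := p.g - p.b + p.a) (by omega) u
  have f3 := eval_block_succ_mul (lo := p.a - p.b + 1) (hi := p.f) (by omega) (u / 2)
  have f4 := eval_block_succ_mul (lo := p.e) (hi := p.e + p.f) (by omega) (u / 2)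
  have f5 := eval_block_succ_mul (lo := p.a) (hi := p.g) (by omega) (u / 2)
  rw [show u + 1 + 1 = u + 2 by ring] at f1
  set X2 := (block (p.a + 1) (p.g - p.b + p.a)).eval (u + 2)
  set W2 := (block (p.a + 1) (p.g - p.b + p.a)).eval (u + 1)
  set Y2 := (block (p.a + 1) (p.g - p.b + p.a)).eval u
  set Xh := (block (p.a - p.b + 1) p.f).eval (u / 2 + 1)
  set Yh := (block (p.a - p.b + 1) p.f).eval (u / 2)
  set Xe := (block p.e (p.e + p.f)).eval (u / 2 + 1)
  set Ye := (block p.e (p.e + p.f)).eval (u / 2)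
  set Xa := (block p.a p.g).eval (u / 2 + 1)
  set Ya := (block p.a p.g).eval (u / 2)
  set t := u / 2 with ht
  push_cast at f1 f2 f3 f4 f5 ⊢
  linear_combination
    (p.kap * Xh * (u + p.a + 1) * (t + (p.a - p.b + 1)) * (t + (p.e + p.f)) * (t + p.g) * (Ye * Ya)) * f1
    + (p.kap * (u + 1 + (p.g - p.b + p.a)) * Xh * (t + (p.a - p.b + 1)) * (t + (p.e + p.f)) * (t + p.g) * (Ye * Ya)) * f2
    + (p.kap * Y2 * (u + (p.g - p.b + p.a)) * (u + 1 + (p.g - p.b + p.a)) * (t + (p.e + p.f)) * (t + p.g) * (Ye * Ya)) * f3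
    - (p.kap * Y2 * Yh * (u + (p.g - p.b + p.a)) * (u + 1 + (p.g - p.b + p.a)) * (t + p.f) * (t + p.a) * Xa) * f4
    - (p.kap * Y2 * Yh * (u + (p.g - p.b + p.a)) * (u + 1 + (p.g - p.b + p.a)) * (t + p.f) * (t + (p.e + p.f)) * Ye) * f5

end Pt

end Summit.KontsevichZagierPeriods.Zeta5Search.TwoTaleOmega

end
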